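import Mathlib

/-!
# K1L `LagrangianRenormalisationStep` — crux idea «foreign-slot-hypocoercive-ladder» (planner ad-ideate-p4 g8, lens «control»)

First-lemma sketch for the ONE PDE-mixing input of `stub_cellLawV` clause (V) that no card gives a mechanism for:
p5's K3 «FOREIGN-SLOT DECORRELATION» (card `chang-slow-graph`, rank 4: "NECESSARY for (V) as typed whatever the line").

Object: the cell-scale SIDEBAND LADDER of a cross mode `k₁ = ℓ + n(m_s + j m_{s'})`, `j ∈ ℤ`, inside a foreign shearing
slot `s'` (`m_s · e_{s'} ≠ 0`) of the Lagrangian cell problem (A = 0, Leray-projected, anisotropic constant tensor in the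
step window).  In the energy coordinates of the two polarisations `ê_⊥ = (k₁ × m)/|k₁ × m|` (constant along the ladder) and
`ê₂(j) = k̂_j × ê_⊥` the Leray-projected shear transport SPLITS EXACTLY: the `⊥` component hops with the full unit-shear
coefficient (an exact passive scalar), the in-plane component with the form factor `cos∠(k_j, k_{j+1})` (Orr–Sommerfeld /
Squire without lift-up — the A0 model has no stretching term); the tensor damping is `4π²ν⟨𝔸k_j,k_j⟩/n²`, exactly
quadratic in `j`, with 2×2 polarisation coupling of relative size `O(Λ²·hi/lo − 1) + O(β)`.

Controlling quantity: a Bedrossian–Coti Zelati / He hypocoercive augmented energy on the ladder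
`Φ = Σ‖v_j‖² + α Σ(κ+j)²‖v_j‖² + β' Re Σ (κ+j) conj(v_j)·(C v)_j + γ Σ‖(C v)_j‖²`, `C` = the SYMMETRIC hopping
(`[position, skew hopping] = symmetric hopping` — the ladder form of `[∂_y, u∂_x] = u'∂_x`), frozen on windows of the slot
plateau / mid-half; it certifies decay at a rate `≥ c·D^p A^{1-p}` with `p < 1` (`p = 1/2` expected: nondegenerate critical
points of `sin`), i.e. FASTER THAN THE BARE SIDEBAND DAMPING `D` by a factor `→ ∞` as `ν → 0` — whereas (V)'s `ν^σ` typing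
needs only a LOGARITHMIC enhancement (`survival ≤ ν^σ ⇐ rate·(Mτ/2ν) ≥ σ log(1/ν)`).

Everything below is a statement sketch (Props only, no axioms, no sorry); it elaborates against Mathlib alone.
-/

set_option linter.dupNamespace false -- layout D-0017

namespace Summit.AnomalousDissipation.AnomalousDissipation.Cruxes.LagrangianRenormalisationStep.ForeignSlotHypocoerciveLadder

open Finset Real

/-- **Sheared-ladder enhanced decay** (the First lemma, abstract finite-dimensional form in the typing conventions of
`Theorems.…LadderFunctionalTridiagonal.ladderFunctional_decay_intWindow`).  Window `W ⊆ ℤ` containing `[-N, N]` with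
`A ≤ D N²` (sites of damping `≥ A` within reach), damping `d_J ∈ [D(κ+J)², θ D(1+(κ+J)²)]` (the tensor symbol along the
ladder, two-sided by the step window), real links `|h_J| ≤ 1` with `|h_J| ≥ h₀` for all but at most ONE index (the lattice
one-cut lemma below), a slowly modulated envelope `a(t) ∈ [1/2, 1]`, `|a s − a t| ≤ D|s − t|` (slot mid-half of the
trapezoid; on a plateau `a ≡ 1`), Dirichlet-truncated state `v : ℝ → ℤ → ℂ` with
`v_J' = −d_J v_J + A·a(t)·(h_{J−1} v_{J−1} − h_J v_{J+1})`.  Conclusion: uniform (in `W`, `κ`, `a`, the position of the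
weak link) exponential decay at the ENHANCED rate `c·D^p·A^{1−p}`. -/
def ShearedLadderEnhancedDecay (p c C θ h₀ : ℝ) : Prop :=
  ∀ (W : Finset ℤ) (N : ℕ) (d h : ℤ → ℝ) (D A κ t₀ t₁ : ℝ) (a : ℝ → ℝ) (v : ℝ → ℤ → ℂ),
    0 < D → D ≤ A → A ≤ D * (N : ℝ) ^ 2 → Finset.Icc (-(N : ℤ)) (N : ℤ) ⊆ W →
    (∀ J ∈ W, D * (κ + J) ^ 2 ≤ d J ∧ d J ≤ θ * D * (1 + (κ + J) ^ 2)) →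
    (∀ J, |h J| ≤ 1) → (∃ Jw : ℤ, ∀ J, J ≠ Jw → h₀ ≤ |h J|) →
    (∀ t ∈ Set.Icc t₀ t₁, 1 / 2 ≤ a t ∧ a t ≤ 1) → (∀ s ∈ Set.Icc t₀ t₁, ∀ t ∈ Set.Icc t₀ t₁, |a s - a t| ≤ D * |s - t|) →
    (∀ t ∈ Set.Icc t₀ t₁, ∀ J, J ∉ W → v t J = 0) →
    (∀ t ∈ Set.Icc t₀ t₁, ∀ J ∈ W, HasDerivWithinAt (fun s => v s J)
        (-((d J : ℝ) : ℂ) * v t J +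
          ((A * a t : ℝ) : ℂ) * (((h (J - 1) : ℝ) : ℂ) * v t (J - 1) - ((h J : ℝ) : ℂ) * v t (J + 1)))
        (Set.Icc t₀ t₁) t) →
    ∀ t ∈ Set.Icc t₀ t₁, ∑ J ∈ W, ‖v t J‖ ^ 2 ≤
      C * Real.exp (-(c * D ^ p * A ^ (1 - p)) * (t - t₀)) * ∑ J ∈ W, ‖v t₀ J‖ ^ 2

/-- **First lemma (the claim to prove first)**: for every ellipticity ratio `θ ≥ 1` of the damping and every weak-link
floor `h₀ > 0` there are an exponent `p < 1` and constants `c > 0`, `C ≥ 1` with `ShearedLadderEnhancedDecay p c C θ h₀`.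
(`p = 1/2`, `C = e`, `c = c(θ, h₀)` is the Bedrossian–Coti Zelati / He prediction; ANY `p < 1` serves (V).) -/
def FirstLemma : Prop :=
  ∀ θ h₀ : ℝ, 1 ≤ θ → 0 < h₀ → ∃ p c C : ℝ, p < 1 ∧ 0 < c ∧ 1 ≤ C ∧ ShearedLadderEnhancedDecay p c C θ h₀

/-- **Lattice one-cut lemma** (supplies the "at most one weak link" hypothesis): along the ladder `k_J = m_s + J m` of two
NON-PARALLEL lattice vectors, consecutive wave-vectors are orthogonal (in-plane form factor `cos∠(k_J,k_{J+1}) = 0`) for at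
most one `J` — since `|m_s + t m|² = |m|²(t − t⋆)² + dist²` takes the value `|m|²/4` at two half-integers `≥ 1` apart only if
`dist = 0`, i.e. `m_s ∥ m`.  (Cuts do occur: `m_s = (1,1,0)`, `m = (1,1,1)`, `J = −1`; `m_s = (1,0,0)`, `m = (1,1,0)`, `J = −1`.) -/
def LatticeLadderAtMostOneCut : Prop :=
  ∀ ms m : Fin 3 → ℤ, (∀ a b : ℤ, a • ms = b • m → a = 0 ∧ b = 0) →
    ∀ j₁ j₂ : ℤ, (∑ i, (ms i + j₁ * m i) * (ms i + (j₁ + 1) * m i)) = 0 →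
      (∑ i, (ms i + j₂ * m i) * (ms i + (j₂ + 1) * m i)) = 0 → j₁ = j₂

/-- **Log-enhancement calibration** (why ANY `p < 1` serves clause (V)): if a cross-mode survival factor through one
foreign slot of cell duration `L = M τ/(2ν)` is `≤ C·exp(−r L)` with `r ≥ g·D`, bare damping `D = 4π² ν q` (`q = |k/n|² ≥ 1`)
and enhancement `g ≥ σ·log(1/ν)/(2π² q M τ)`, then the survival is `≤ C ν^σ` — the error currency of `SlowVectorClause`.
Pure real arithmetic; recorded as the target shape of the bookkeeping step. -/
def LogEnhancementSuffices : Prop :=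
  ∀ (C r g D ν q M τ σ : ℝ), 0 < ν → ν < 1 → 0 < M → 0 < τ → 1 ≤ q → 0 < σ →
    D = 4 * π ^ 2 * ν * q → g * D ≤ r → σ * Real.log (1 / ν) / (2 * π ^ 2 * q * M * τ) ≤ g → 0 ≤ C →
    C * Real.exp (-(r * (M * τ / (2 * ν)))) ≤ C * ν ^ σ

end Summit.AnomalousDissipation.AnomalousDissipation.Cruxes.LagrangianRenormalisationStep.ForeignSlotHypocoerciveLadder

/-! ## Proofs of the two elementary companions (the First lemma itself is the prover's) -/

namespace Summit.AnomalousDissipation.AnomalousDissipation.Cruxes.LagrangianRenormalisationStep.ForeignSlotHypocoerciveLadder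

open Finset Real

/-- The calibration is real arithmetic: `r·L ≥ g·D·L = g·2π²qMτ ≥ σ log(1/ν)`. -/
theorem logEnhancementSuffices : LogEnhancementSuffices := by
  intro C r g D ν q M τ σ hν hν1 hM hτ hq hσ hD hr hg hC
  apply mul_le_mul_of_nonneg_left _ hC
  have hq0 : 0 < q := by linarith
  have hL : 0 < M * τ / (2 * ν) := by positivity
  have hK : 0 < 2 * π ^ 2 * q * M * τ := by positivity
  have h1 : σ * Real.log (1 / ν) ≤ g * (2 * π ^ 2 * q * M * τ) := (div_le_iff₀ hK).mp hg
  have h2 : g * D * (M * τ / (2 * ν)) = g * (2 * π ^ 2 * q * M * τ) := by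
    rw [hD]; field_simp; ring
  have h3 : g * D * (M * τ / (2 * ν)) ≤ r * (M * τ / (2 * ν)) := mul_le_mul_of_nonneg_right hr hL.le
  have h4 : σ * Real.log (1 / ν) ≤ r * (M * τ / (2 * ν)) := by rw [h2] at h3; linarith
  have h5 : Real.log (1 / ν) = -Real.log ν := by rw [one_div, Real.log_inv]
  rw [h5] at h4
  rw [Real.rpow_def_of_pos hν, mul_comm (Real.log ν) σ]
  apply Real.exp_le_exp.mpr
  linarith

/-- Scalar core of the one-cut lemma (explicit components): two distinct integer zeros of
`f(j) = (m_s + j m)·(m_s + (j+1) m)` force `|m|²·m_s = (m_s·m)·m` componentwise. -/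
theorem oneCut_aux (a1 a2 a3 b1 b2 b3 j₁ j₂ : ℤ)
    (h1 : (a1 + j₁ * b1) * (a1 + (j₁ + 1) * b1) + (a2 + j₁ * b2) * (a2 + (j₁ + 1) * b2) +
        (a3 + j₁ * b3) * (a3 + (j₁ + 1) * b3) = 0)
    (h2 : (a1 + j₂ * b1) * (a1 + (j₂ + 1) * b1) + (a2 + j₂ * b2) * (a2 + (j₂ + 1) * b2) +
        (a3 + j₂ * b3) * (a3 + (j₂ + 1) * b3) = 0)
    (hne : j₁ ≠ j₂) :
    (b1 * b1 + b2 * b2 + b3 * b3) * a1 = (a1 * b1 + a2 * b2 + a3 * b3) * b1 ∧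
    (b1 * b1 + b2 * b2 + b3 * b3) * a2 = (a1 * b1 + a2 * b2 + a3 * b3) * b2 ∧
    (b1 * b1 + b2 * b2 + b3 * b3) * a3 = (a1 * b1 + a2 * b2 + a3 * b3) * b3 := by
  have hd : j₁ - j₂ ≠ 0 := sub_ne_zero.mpr hne
  -- E1: 2P + Q(j₁+j₂+1) = 0
  have hE : (j₁ - j₂) * (2 * (a1 * b1 + a2 * b2 + a3 * b3) + (b1 * b1 + b2 * b2 + b3 * b3) * (j₁ + j₂ + 1)) = 0 := by
    linear_combination h1 - h2
  have hE1 : 2 * (a1 * b1 + a2 * b2 + a3 * b3) + (b1 * b1 + b2 * b2 + b3 * b3) * (j₁ + j₂ + 1) = 0 := by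
    rcases mul_eq_zero.mp hE with h | h
    · exact absurd h hd
    · exact h
  -- T: Q²((j₁−j₂)²−1) + 4·Gram = 0
  have hT : (b1 * b1 + b2 * b2 + b3 * b3) ^ 2 * ((j₁ - j₂) ^ 2 - 1) +
      4 * ((a1 * b2 - a2 * b1) ^ 2 + (a1 * b3 - a3 * b1) ^ 2 + (a2 * b3 - a3 * b2) ^ 2) = 0 := by
    linear_combination (4 * (b1 * b1 + b2 * b2 + b3 * b3)) * h1 -
      (2 * (a1 * b1 + a2 * b2 + a3 * b3) - (b1 * b1 + b2 * b2 + b3 * b3) * (j₁ + j₂ + 1) +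
        2 * (b1 * b1 + b2 * b2 + b3 * b3) * (2 * j₁ + 1)) * hE1
  have hdsq : 1 ≤ (j₁ - j₂) ^ 2 := (one_le_sq_iff_one_le_abs _).mpr (Int.one_le_abs hd)
  have hprod : 0 ≤ (b1 * b1 + b2 * b2 + b3 * b3) ^ 2 * ((j₁ - j₂) ^ 2 - 1) :=
    mul_nonneg (sq_nonneg _) (sub_nonneg.mpr hdsq)
  have hG0 : (a1 * b2 - a2 * b1) ^ 2 + (a1 * b3 - a3 * b1) ^ 2 + (a2 * b3 - a3 * b2) ^ 2 = 0 := by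
    linarith [sq_nonneg (a1 * b2 - a2 * b1), sq_nonneg (a1 * b3 - a3 * b1), sq_nonneg (a2 * b3 - a3 * b2)]
  -- Σ_i (Q a_i − P b_i)² = Q·Gram
  have hsum : ((b1 * b1 + b2 * b2 + b3 * b3) * a1 - (a1 * b1 + a2 * b2 + a3 * b3) * b1) ^ 2 +
      ((b1 * b1 + b2 * b2 + b3 * b3) * a2 - (a1 * b1 + a2 * b2 + a3 * b3) * b2) ^ 2 +
      ((b1 * b1 + b2 * b2 + b3 * b3) * a3 - (a1 * b1 + a2 * b2 + a3 * b3) * b3) ^ 2 = 0 := by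
    have : ((b1 * b1 + b2 * b2 + b3 * b3) * a1 - (a1 * b1 + a2 * b2 + a3 * b3) * b1) ^ 2 +
        ((b1 * b1 + b2 * b2 + b3 * b3) * a2 - (a1 * b1 + a2 * b2 + a3 * b3) * b2) ^ 2 +
        ((b1 * b1 + b2 * b2 + b3 * b3) * a3 - (a1 * b1 + a2 * b2 + a3 * b3) * b3) ^ 2 =
        (b1 * b1 + b2 * b2 + b3 * b3) *
          ((a1 * b2 - a2 * b1) ^ 2 + (a1 * b3 - a3 * b1) ^ 2 + (a2 * b3 - a3 * b2) ^ 2) := by ring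
    rw [this, hG0, mul_zero]
  have hs1 : ((b1 * b1 + b2 * b2 + b3 * b3) * a1 - (a1 * b1 + a2 * b2 + a3 * b3) * b1) ^ 2 = 0 := by
    linarith [sq_nonneg ((b1 * b1 + b2 * b2 + b3 * b3) * a1 - (a1 * b1 + a2 * b2 + a3 * b3) * b1),
      sq_nonneg ((b1 * b1 + b2 * b2 + b3 * b3) * a2 - (a1 * b1 + a2 * b2 + a3 * b3) * b2),
      sq_nonneg ((b1 * b1 + b2 * b2 + b3 * b3) * a3 - (a1 * b1 + a2 * b2 + a3 * b3) * b3)]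
  have hs2 : ((b1 * b1 + b2 * b2 + b3 * b3) * a2 - (a1 * b1 + a2 * b2 + a3 * b3) * b2) ^ 2 = 0 := by
    linarith [sq_nonneg ((b1 * b1 + b2 * b2 + b3 * b3) * a1 - (a1 * b1 + a2 * b2 + a3 * b3) * b1),
      sq_nonneg ((b1 * b1 + b2 * b2 + b3 * b3) * a2 - (a1 * b1 + a2 * b2 + a3 * b3) * b2),
      sq_nonneg ((b1 * b1 + b2 * b2 + b3 * b3) * a3 - (a1 * b1 + a2 * b2 + a3 * b3) * b3)]
  have hs3 : ((b1 * b1 + b2 * b2 + b3 * b3) * a3 - (a1 * b1 + a2 * b2 + a3 * b3) * b3) ^ 2 = 0 := by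
    linarith [sq_nonneg ((b1 * b1 + b2 * b2 + b3 * b3) * a1 - (a1 * b1 + a2 * b2 + a3 * b3) * b1),
      sq_nonneg ((b1 * b1 + b2 * b2 + b3 * b3) * a2 - (a1 * b1 + a2 * b2 + a3 * b3) * b2),
      sq_nonneg ((b1 * b1 + b2 * b2 + b3 * b3) * a3 - (a1 * b1 + a2 * b2 + a3 * b3) * b3)]
  refine ⟨?_, ?_, ?_⟩
  · exact sub_eq_zero.mp ((pow_eq_zero_iff two_ne_zero).mp hs1)
  · exact sub_eq_zero.mp ((pow_eq_zero_iff two_ne_zero).mp hs2)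
  · exact sub_eq_zero.mp ((pow_eq_zero_iff two_ne_zero).mp hs3)

/-- The lattice one-cut lemma: with `P = m_s·m`, `Q = |m|²`, `R = |m_s|²`, `f(j) = R + (2j+1)P + j(j+1)Q`; two distinct
integer zeros `j₁ ≠ j₂` give `2P + Q(j₁+j₂+1) = 0` and then `Q²((j₁−j₂)² − 1) + 4(QR − P²) = 0`; since the Gram determinant
`QR − P² = |m_s × m|² ≥ 0` and `(j₁−j₂)² ≥ 1`, both vanish, so `Q·m_s = P·m`, i.e. `m_s ∥ m` — excluded. -/
theorem latticeLadderAtMostOneCut : LatticeLadderAtMostOneCut := by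
  intro ms m hind j₁ j₂ h1 h2
  by_contra hne
  simp only [Fin.sum_univ_three] at h1 h2
  obtain ⟨hc1, hc2, hc3⟩ := oneCut_aux (ms 0) (ms 1) (ms 2) (m 0) (m 1) (m 2) j₁ j₂ h1 h2 hne
  have hpar : (m 0 * m 0 + m 1 * m 1 + m 2 * m 2) • ms = (ms 0 * m 0 + ms 1 * m 1 + ms 2 * m 2) • m := by
    funext i
    fin_cases i
    · simpa using hc1
    · simpa using hc2
    · simpa using hc3
  have hQ0 : m 0 * m 0 + m 1 * m 1 + m 2 * m 2 = 0 := (hind _ _ hpar).1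
  have hb0 : m 0 = 0 := mul_self_eq_zero.mp (by nlinarith [mul_self_nonneg (m 0), mul_self_nonneg (m 1), mul_self_nonneg (m 2)])
  have hb1 : m 1 = 0 := mul_self_eq_zero.mp (by nlinarith [mul_self_nonneg (m 0), mul_self_nonneg (m 1), mul_self_nonneg (m 2)])
  have hb2 : m 2 = 0 := mul_self_eq_zero.mp (by nlinarith [mul_self_nonneg (m 0), mul_self_nonneg (m 1), mul_self_nonneg (m 2)])
  have hm0 : m = 0 := by
    funext i
    fin_cases i
    · simpa using hb0
    · simpa using hb1
    · simpa using hb2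
  have h := (hind 0 1 (by rw [hm0]; simp)).2
  exact one_ne_zero h

end Summit.AnomalousDissipation.AnomalousDissipation.Cruxes.LagrangianRenormalisationStep.ForeignSlotHypocoerciveLadder
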